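import Literature.Topology.FourManifolds.RegularSublevelMaps
import HarnessLib

/-!
# Gluing self-diffeomorphisms of the boundary of a regular sublevel set from ambient models

Topic `Literature/Topology/FourManifolds`; companion of `RegularSublevelMaps.lean`
(`RegularSublevel.boundaryRestrict`: a smooth ambient map `e : M → M` with `f ∘ e = f` restricts to
a smooth self-map of the boundary `∂Mᵃ = f⁻¹(a)` of the regular sublevel set `Mᵃ = {f ≤ a}`), written
for the Dehn twists of the Dehn–Nielsen–Baer seat (`DehnNielsenBaerSurface.lean`): a Dehn twist of
the boundary surface `∂V ⊂ ℝ³` of a handlebody `V = {f ≤ a}` about a curve that bounds a disc on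
neither side is **not** the restriction of an `f`-preserving diffeomorphism of `ℝ³` (such a
diffeomorphism preserves `V`, and a Dehn twist extending over `V` is a twist about a meridian), but
it is, near every point of `∂V`, the restriction of one of two `f`-preserving smooth ambient maps —
a time-`λ` map of an `f`-preserving flow near the twisting annulus, the identity elsewhere — which
agree on the overlap *along `∂V`* (not ambiently).  This file glues such local ambient models:

* `RegularSublevel.boundaryGlue h e₁ e₂ he₁ he₂ O` — the self-map of `∂Mᵃ` equal to (the restriction
  of) `e₁` over the ambient set `O` and to `e₂` elsewhere; `incl_boundaryGlue_of_mem/_of_not_mem`;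
* `RegularSublevel.contMDiff_boundaryGlue` — **it is smooth** as soon as `e₁`, `e₂` are smooth, `O`
  and a second ambient open set `O'` cover the level `f = a`, and `e₁ = e₂` on `f⁻¹(a) ∩ O ∩ O'`;
* `RegularSublevel.boundaryGlueDiffeomorph` — **the self-diffeomorphism of `∂Mᵃ`** glued from an
  ambient model `e` on an open set `O ⊇ K` (`K` closed) which is the identity on `f⁻¹(a) ∩ (O ∖ K)`,
  maps `f⁻¹(a) ∩ O` into `O` and has there the two-sided inverse `e'` (another such model), and the
  identity off `K`; `incl_boundaryGlueDiffeomorph_of_mem/_of_not_mem` (it is `e` over `O` and the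
  identity off `K`, on points of `M`).

Everything is proved; no new definitions of mathematical content beyond the two glued maps.

## References

* J. M. Lee, *Introduction to Smooth Manifolds*, 2nd ed. (2013), Cor. 5.30 (restricting the codomain
  of a smooth map to an embedded submanifold), Lemma 2.26-type gluing of smooth maps agreeing on
  overlaps. [LeeSmoothManifolds2013]
* B. Farb, D. Margalit, *A primer on mapping class groups* (2012), §3.1.1 (Dehn twists are supported
  in an annulus). [FarbMargalit2012]
-/

open scoped Manifold ContDiff Topology
open Set Function Filter

noncomputable section

universe u

namespace Literature.Topology.FourManifolds

/-- Local notation: `𝔼 n` is the model Euclidean space `EuclideanSpace ℝ (Fin n)`. -/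
local notation "𝔼 " n:arg => EuclideanSpace ℝ (Fin n)

namespace RegularSublevel

variable {k : ℕ} {M : Type u} [TopologicalSpace M] [ChartedSpace (𝔼 (k + 1)) M]
  [IsManifold (𝓡 (k + 1)) ∞ M] {f : M → ℝ} {a : ℝ} (h : IsRegularLevel (𝓡 (k + 1)) f a)

open Classical in
/-- **The glued self-map of `∂Mᵃ`**: the restriction of the ambient map `e₁` on the boundary points
lying in the ambient set `O`, that of `e₂` on the others. [folklore] -/
def boundaryGlue (e₁ e₂ : M → M) (he₁ : ∀ x, f (e₁ x) = f x) (he₂ : ∀ x, f (e₂ x) = f x)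
    (O : Set M) :
    (𝓡∂ (k + 1)).boundary (RegularSublevel h) → (𝓡∂ (k + 1)).boundary (RegularSublevel h) :=
  fun z => if incl h z.1 ∈ O then boundaryRestrict h h e₁ he₁ z else boundaryRestrict h h e₂ he₂ z

/-- Over `O` the glued map is `e₁` on points of `M`. [folklore] -/
theorem incl_boundaryGlue_of_mem {e₁ e₂ : M → M} (he₁ : ∀ x, f (e₁ x) = f x)
    (he₂ : ∀ x, f (e₂ x) = f x) {O : Set M} {z : (𝓡∂ (k + 1)).boundary (RegularSublevel h)}
    (hz : incl h z.1 ∈ O) : incl h (boundaryGlue h e₁ e₂ he₁ he₂ O z).1 = e₁ (incl h z.1) := by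
  rw [boundaryGlue, if_pos hz]; rfl

/-- Off `O` the glued map is `e₂` on points of `M`. [folklore] -/
theorem incl_boundaryGlue_of_not_mem {e₁ e₂ : M → M} (he₁ : ∀ x, f (e₁ x) = f x)
    (he₂ : ∀ x, f (e₂ x) = f x) {O : Set M} {z : (𝓡∂ (k + 1)).boundary (RegularSublevel h)}
    (hz : incl h z.1 ∉ O) : incl h (boundaryGlue h e₁ e₂ he₁ he₂ O z).1 = e₂ (incl h z.1) := by
  rw [boundaryGlue, if_neg hz]; rfl

omit [TopologicalSpace M] [ChartedSpace (𝔼 (k + 1)) M] [IsManifold (𝓡 (k + 1)) ∞ M] in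
/-- The identity preserves `f` (stated with `id` syntactically, for the glued maps below).
[folklore] -/
theorem apply_id_eq (f : M → ℝ) : ∀ x, f (id x) = f x := fun _ => rfl

/-- The ambient position `z ↦ incl z` of a boundary point is continuous. [folklore] -/
theorem continuous_incl_boundary :
    Continuous fun z : (𝓡∂ (k + 1)).boundary (RegularSublevel h) => incl h z.1 :=
  (continuous_incl h).comp continuous_subtype_val

/-- **The glued map is smooth** when `e₁`, `e₂` are smooth, the ambient open sets `O`, `O'` cover
the level `f = a`, and the two models agree on `f⁻¹(a) ∩ O ∩ O'` (smoothness is local, and on the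
open sets `{incl ∈ O}`, `{incl ∈ O'}` of `∂Mᵃ` the glued map is the restriction of `e₁`, resp. `e₂`).
[cite: LeeSmoothManifolds2013, Cor. 5.30] -/
theorem contMDiff_boundaryGlue {e₁ e₂ : M → M} (hs₁ : ContMDiff (𝓡 (k + 1)) (𝓡 (k + 1)) ∞ e₁)
    (hs₂ : ContMDiff (𝓡 (k + 1)) (𝓡 (k + 1)) ∞ e₂) (he₁ : ∀ x, f (e₁ x) = f x)
    (he₂ : ∀ x, f (e₂ x) = f x) {O O' : Set M} (hO : IsOpen O) (hO' : IsOpen O')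
    (hcover : ∀ x, f x = a → x ∈ O ∨ x ∈ O')
    (hagree : ∀ x, f x = a → x ∈ O → x ∈ O' → e₁ x = e₂ x) :
    ContMDiff (𝓡 k) (𝓡 k) ∞ (boundaryGlue h e₁ e₂ he₁ he₂ O) := by
  intro z
  by_cases hz : incl h z.1 ∈ O
  · refine (contMDiff_boundaryRestrict h h hs₁ he₁ z).congr_of_eventuallyEq ?_
    filter_upwards [(hO.preimage (continuous_incl_boundary h)).mem_nhds hz] with w hw
    exact if_pos hw
  · have hz' : incl h z.1 ∈ O' := (hcover _ (apply_incl_boundary h z)).resolve_left hz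
    refine (contMDiff_boundaryRestrict h h hs₂ he₂ z).congr_of_eventuallyEq ?_
    filter_upwards [(hO'.preimage (continuous_incl_boundary h)).mem_nhds hz'] with w hw
    by_cases hwO : incl h w.1 ∈ O
    · dsimp only [boundaryGlue]
      rw [if_pos hwO]
      refine Subtype.ext (injective_incl h ?_)
      show incl h (map h h e₁ he₁ w.1) = incl h (map h h e₂ he₂ w.1)
      rw [incl_map, incl_map]
      exact hagree _ (apply_incl_boundary h w) hwO hw
    · exact if_neg hwO

/-- **The self-diffeomorphism of `∂Mᵃ` glued from a local ambient model.**  Data: smooth ambient maps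
`e`, `e'` preserving `f`; an open set `O` and a closed set `K ⊆ O` of `M` such that, at the points
of the level `f = a` lying in `O`, both maps are the identity off `K`, take values in `O`, and are
inverse to each other.  The diffeomorphism is `e` over `O` and the identity off `K`; its inverse is
glued from `e'` likewise. [cite: LeeSmoothManifolds2013, Cor. 5.30] [cite: FarbMargalit2012, §3.1.1] -/
def boundaryGlueDiffeomorph {e e' : M → M} (hs : ContMDiff (𝓡 (k + 1)) (𝓡 (k + 1)) ∞ e)
    (hs' : ContMDiff (𝓡 (k + 1)) (𝓡 (k + 1)) ∞ e') (he : ∀ x, f (e x) = f x)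
    (he' : ∀ x, f (e' x) = f x) {O K : Set M} (hO : IsOpen O) (hK : IsClosed K) (hKO : K ⊆ O)
    (hid : ∀ x, f x = a → x ∈ O → x ∉ K → e x = x ∧ e' x = x)
    (hmaps : ∀ x, f x = a → x ∈ O → e x ∈ O ∧ e' x ∈ O)
    (hinv : ∀ x, f x = a → x ∈ O → e' (e x) = x ∧ e (e' x) = x) :
    (𝓡∂ (k + 1)).boundary (RegularSublevel h) ≃ₘ⟮𝓡 k, 𝓡 k⟯
      (𝓡∂ (k + 1)).boundary (RegularSublevel h) where
  toFun := boundaryGlue h e id he (apply_id_eq f) O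
  invFun := boundaryGlue h e' id he' (apply_id_eq f) O
  left_inv z := by
    refine Subtype.ext (injective_incl h ?_)
    by_cases hz : incl h z.1 ∈ O
    · have h1 := incl_boundaryGlue_of_mem h he (apply_id_eq f) hz
      have h2 : incl h (boundaryGlue h e id he (apply_id_eq f) O z).1 ∈ O := by
        rw [h1]; exact (hmaps _ (apply_incl_boundary h z) hz).1
      rw [incl_boundaryGlue_of_mem h he' (apply_id_eq f) h2, h1]
      exact (hinv _ (apply_incl_boundary h z) hz).1
    · have h1 := incl_boundaryGlue_of_not_mem h he (apply_id_eq f) hz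
      have h2 : incl h (boundaryGlue h e id he (apply_id_eq f) O z).1 ∉ O := by
        rw [h1]; exact hz
      rw [incl_boundaryGlue_of_not_mem h he' (apply_id_eq f) h2, h1]; rfl
  right_inv z := by
    refine Subtype.ext (injective_incl h ?_)
    by_cases hz : incl h z.1 ∈ O
    · have h1 := incl_boundaryGlue_of_mem h he' (apply_id_eq f) hz
      have h2 : incl h (boundaryGlue h e' id he' (apply_id_eq f) O z).1 ∈ O := by
        rw [h1]; exact (hmaps _ (apply_incl_boundary h z) hz).2
      rw [incl_boundaryGlue_of_mem h he (apply_id_eq f) h2, h1]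
      exact (hinv _ (apply_incl_boundary h z) hz).2
    · have h1 := incl_boundaryGlue_of_not_mem h he' (apply_id_eq f) hz
      have h2 : incl h (boundaryGlue h e' id he' (apply_id_eq f) O z).1 ∉ O := by
        rw [h1]; exact hz
      rw [incl_boundaryGlue_of_not_mem h he (apply_id_eq f) h2, h1]; rfl
  contMDiff_toFun :=
    contMDiff_boundaryGlue h hs contMDiff_id he (apply_id_eq f) hO hK.isOpen_compl
      (fun x _ => by by_cases hx : x ∈ K; exacts [Or.inl (hKO hx), Or.inr hx])
      fun x hx hxO hxK => (hid x hx hxO hxK).1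
  contMDiff_invFun :=
    contMDiff_boundaryGlue h hs' contMDiff_id he' (apply_id_eq f) hO hK.isOpen_compl
      (fun x _ => by by_cases hx : x ∈ K; exacts [Or.inl (hKO hx), Or.inr hx])
      fun x hx hxO hxK => (hid x hx hxO hxK).2

/-- Over `O` the glued diffeomorphism is `e` on points of `M`. [folklore] -/
theorem incl_boundaryGlueDiffeomorph_of_mem {e e' : M → M}
    (hs : ContMDiff (𝓡 (k + 1)) (𝓡 (k + 1)) ∞ e) (hs' : ContMDiff (𝓡 (k + 1)) (𝓡 (k + 1)) ∞ e')
    (he : ∀ x, f (e x) = f x) (he' : ∀ x, f (e' x) = f x) {O K : Set M} (hO : IsOpen O)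
    (hK : IsClosed K) (hKO : K ⊆ O) (hid : ∀ x, f x = a → x ∈ O → x ∉ K → e x = x ∧ e' x = x)
    (hmaps : ∀ x, f x = a → x ∈ O → e x ∈ O ∧ e' x ∈ O)
    (hinv : ∀ x, f x = a → x ∈ O → e' (e x) = x ∧ e (e' x) = x)
    {z : (𝓡∂ (k + 1)).boundary (RegularSublevel h)} (hz : incl h z.1 ∈ O) :
    incl h (boundaryGlueDiffeomorph h hs hs' he he' hO hK hKO hid hmaps hinv z).1 =
      e (incl h z.1) :=
  incl_boundaryGlue_of_mem h he (apply_id_eq f) hz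

/-- Off `K` the glued diffeomorphism is the identity on points of `M`. [folklore] -/
theorem incl_boundaryGlueDiffeomorph_of_not_mem {e e' : M → M}
    (hs : ContMDiff (𝓡 (k + 1)) (𝓡 (k + 1)) ∞ e) (hs' : ContMDiff (𝓡 (k + 1)) (𝓡 (k + 1)) ∞ e')
    (he : ∀ x, f (e x) = f x) (he' : ∀ x, f (e' x) = f x) {O K : Set M} (hO : IsOpen O)
    (hK : IsClosed K) (hKO : K ⊆ O) (hid : ∀ x, f x = a → x ∈ O → x ∉ K → e x = x ∧ e' x = x)
    (hmaps : ∀ x, f x = a → x ∈ O → e x ∈ O ∧ e' x ∈ O)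
    (hinv : ∀ x, f x = a → x ∈ O → e' (e x) = x ∧ e (e' x) = x)
    {z : (𝓡∂ (k + 1)).boundary (RegularSublevel h)} (hz : incl h z.1 ∉ K) :
    incl h (boundaryGlueDiffeomorph h hs hs' he he' hO hK hKO hid hmaps hinv z).1 = incl h z.1 := by
  by_cases hzO : incl h z.1 ∈ O
  · rw [incl_boundaryGlueDiffeomorph_of_mem h hs hs' he he' hO hK hKO hid hmaps hinv hzO]
    exact (hid _ (apply_incl_boundary h z) hzO hz).1
  · exact incl_boundaryGlue_of_not_mem h he (apply_id_eq f) hzO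

/-- **The glued diffeomorphism fixes every boundary point off `K`** (as a point of `∂Mᵃ`).
[folklore] -/
theorem boundaryGlueDiffeomorph_apply_of_not_mem {e e' : M → M}
    (hs : ContMDiff (𝓡 (k + 1)) (𝓡 (k + 1)) ∞ e) (hs' : ContMDiff (𝓡 (k + 1)) (𝓡 (k + 1)) ∞ e')
    (he : ∀ x, f (e x) = f x) (he' : ∀ x, f (e' x) = f x) {O K : Set M} (hO : IsOpen O)
    (hK : IsClosed K) (hKO : K ⊆ O) (hid : ∀ x, f x = a → x ∈ O → x ∉ K → e x = x ∧ e' x = x)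
    (hmaps : ∀ x, f x = a → x ∈ O → e x ∈ O ∧ e' x ∈ O)
    (hinv : ∀ x, f x = a → x ∈ O → e' (e x) = x ∧ e (e' x) = x)
    {z : (𝓡∂ (k + 1)).boundary (RegularSublevel h)} (hz : incl h z.1 ∉ K) :
    boundaryGlueDiffeomorph h hs hs' he he' hO hK hKO hid hmaps hinv z = z :=
  Subtype.ext (injective_incl h
    (incl_boundaryGlueDiffeomorph_of_not_mem h hs hs' he he' hO hK hKO hid hmaps hinv hz))

end RegularSublevel

end Literature.Topology.FourManifolds

end
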